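import Mathlib
import Literature.Probability.Percolation.PercolationProofs
import Literature.Probability.LatticeModels.ProdBernoulliIndependence
import Literature.Probability.Percolation.KozmaNitzanPinning
import Summits.CriticalPhenomena.PercolationContinuityZ3.Theorems.PercNearOneGluingNoHeavyLowerTailFatMinoritySignedLemma3
import HarnessLib

/-!
# `NoHeavyLowerTail` (stmt-CriticalPhenomena-4575), line fat-minority-linear — the DELETION LEMMA
# (reliability order `a ≤ c` survives conditioning AGAINST the loser `a`)

Route task `nh-dp-fatminority` (gen 5).  `μ = prodBernoulli w`; "`a ≤ c`" means `μ(a ↔ b) ≤ μ(c ↔ b)`.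
Dual of the gluing lemma (`…FatMinorityCertificates`, `le_on_of_le_off`): there, conditioning ON an
increasing event of the WINNER's cluster preserves `a ≤ c`; here, conditioning OFF an increasing event
`Q` of the LOSER's cluster does:
* `le_off_of_le` — `Q` increasing and determined by the open edge cluster of `a`; if `μ(a↔b) ≤ μ(c↔b)`
  then `μ({a↔b} ∖ Q) ≤ μ({c↔b} ∖ Q)`.  From the signed Lemma 3(i) for the pair `(c, a)`:
  `μ(D ∖ Q)·X_Q ≤ μ(D ∩ Q)·X_{Qᶜ}` with `X_Q + X_{Qᶜ} ≥ 0` forces `X_{Qᶜ} ≥ 0`.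
* `le_deleted_of_le` — the case `Q = {s(a,y) open}`: deleting pairs AT the loser keeps it the loser.  For
  the glued-piece certificates this means the anchor `a†` may be assumed unattachable (delete its
  attachments first), and that only deletions away from both `a†` and `c` can break a certificate
  (`FINDINGS-fat-minority-gen5.md` §8–9).
No new definitions.
-/

namespace Summit.CriticalPhenomena.PercolationContinuityZ3.Theorems

open MeasureTheory Set
open Literature.Probability.LatticeModels (prodBernoulli)
open Literature.Probability.Percolation (BondConfig openConn openGraph openGraph_adj openEdgeCluster)
open scoped BigOperators

noncomputable section
open Classical
open Literature.Probability.LatticeModels Literature.Probability.Percolation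

variable {n : ℕ}

/-- **Deletion lemma, abstract form.**  `Q` increasing and determined by the open edge cluster of the
LOSER `a`: if `μ(a↔b) ≤ μ(c↔b)` then `μ({a↔b} ∩ Qᶜ) ≤ μ({c↔b} ∩ Qᶜ)`.
[cite: KozmaNitzan2024, Lemma 3(i) p. 6; VandenbergHaggstromKahn2005, Thm. 1.3–1.4] -/
theorem le_off_of_le (w : Sym2 (Fin n) → unitInterval) (a c b : Fin n) (Q : Set (BondConfig (Fin n)))
    (hQ : ∀ ω ω', ω ∈ Q → openEdgeCluster ω a ⊆ openEdgeCluster ω' a → ω' ∈ Q)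
    (hle : (prodBernoulli w).real (openConn a b) ≤ (prodBernoulli w).real (openConn c b)) :
    (prodBernoulli w).real (openConn a b ∩ Qᶜ) ≤ (prodBernoulli w).real (openConn c b ∩ Qᶜ) := by
  set μ := prodBernoulli w with hμ
  have hmeas : ∀ E : Set (BondConfig (Fin n)), MeasurableSet E := fun _ => MeasurableSet.of_discrete
  -- signed Lemma 3(i) for the pair `(c, a)` (comparison vertex `a`)
  have h := signedLemma3i w c a b Q hQ
  have hab := measureReal_inter_add_sdiff (μ := μ) (s := openConn a b) (t := Q) (hmeas _) (measure_ne_top _ _)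
  have hcb := measureReal_inter_add_sdiff (μ := μ) (s := openConn c b) (t := Q) (hmeas _) (measure_ne_top _ _)
  have hDs := measureReal_inter_add_sdiff (μ := μ) (s := (openConn c a)ᶜ) (t := Q) (hmeas _) (measure_ne_top _ _)
  rw [Set.sdiff_eq] at hab hcb hDs
  have hq1 : 0 ≤ μ.real ((openConn c a)ᶜ ∩ Q) := measureReal_nonneg
  have hq2 : 0 ≤ μ.real ((openConn c a)ᶜ ∩ Qᶜ) := measureReal_nonneg
  by_cases hD : μ.real (openConn c a)ᶜ = 0
  · -- degenerate: `a ↔ c` a.s.; then `{a↔b} = {c↔b}` a.s.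
    have h1 : μ.real (openConn a b ∩ Qᶜ) ≤
        μ.real ((openConn a b ∩ Qᶜ) ∩ openConn c a) + μ.real (openConn c a)ᶜ := by
      calc μ.real (openConn a b ∩ Qᶜ)
          ≤ μ.real (((openConn a b ∩ Qᶜ) ∩ openConn c a) ∪ (openConn c a)ᶜ) :=
            measureReal_mono (fun ω hω => by
              by_cases h : ω ∈ (openConn c a : Set (BondConfig (Fin n)))
              · exact Or.inl ⟨hω, h⟩
              · exact Or.inr h) (measure_ne_top _ _)
        _ ≤ _ := measureReal_union_le _ _
    have h2 : μ.real ((openConn a b ∩ Qᶜ) ∩ openConn c a) ≤ μ.real (openConn c b ∩ Qᶜ) :=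
      measureReal_mono (fun ω ⟨⟨hab', hq⟩, hca⟩ =>
        ⟨(hca : (openGraph ω).Reachable c a).trans (hab' : (openGraph ω).Reachable a b), hq⟩)
        (measure_ne_top _ _)
    linarith
  · have hDpos : 0 < μ.real (openConn c a)ᶜ := lt_of_le_of_ne measureReal_nonneg (Ne.symm hD)
    -- `μ(D ∖ Q) X_Q ≤ μ(D ∩ Q) X_{Qᶜ}`, `X_Q + X_{Qᶜ} ≥ 0`, `μ(D ∖ Q) + μ(D ∩ Q) > 0`
    by_contra hneg
    rw [not_le] at hneg
    by_cases hq1' : μ.real ((openConn c a)ᶜ ∩ Q) = 0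
    · rw [hq1'] at h hDs
      nlinarith [h, hab, hcb, hDs, hle, hneg, hq2, hDpos]
    · have hq1pos : 0 < μ.real ((openConn c a)ᶜ ∩ Q) := lt_of_le_of_ne hq1 (Ne.symm hq1')
      nlinarith [h, hab, hcb, hDs, hle, hneg, hq2, hDpos, hq1pos,
        mul_pos hq1pos (sub_pos.2 hneg)]

/-- The event "the pair `s(a, y)` is open" (`y ≠ a`) is increasing and determined by the open edge
cluster of `a`. [folklore] -/
theorem setOf_mem_pair_upClosure' (a y : Fin n) (hya : y ≠ a) :
    ∀ ω ω' : BondConfig (Fin n), ω ∈ {ω : BondConfig (Fin n) | s(a, y) ∈ ω} →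
      openEdgeCluster ω a ⊆ openEdgeCluster ω' a → ω' ∈ {ω : BondConfig (Fin n) | s(a, y) ∈ ω} := by
  intro ω ω' hω hsub
  have hmem : s(a, y) ∈ openEdgeCluster ω a := by
    refine ⟨hω, ?_, ?_⟩
    · rw [Sym2.mk_isDiag_iff]; exact hya.symm
    · intro v hv
      rcases Sym2.mem_iff.1 hv with h | h
      · rw [h]
      · rw [h]; exact SimpleGraph.Adj.reachable ((openGraph_adj ω a y).2 ⟨hω, hya.symm⟩)
  exact openEdgeCluster_subset ω' a (hsub hmem)

/-- **Deletion lemma for one pair.**  If `a ≤ c` holds for `w` then it holds with any pair `s(a, y)` at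
the loser `a` DELETED (`pinW w {s(a,y)} ∅`), provided `w s(a,y) < 1`.
[cite: KozmaNitzan2024, Lemma 3(i) p. 6] -/
theorem le_deleted_of_le (w : Sym2 (Fin n) → unitInterval) (a c b y : Fin n) (hya : y ≠ a)
    (hle : (prodBernoulli w).real (openConn a b) ≤ (prodBernoulli w).real (openConn c b))
    (hw : w s(a, y) < 1) :
    (prodBernoulli (pinW w {s(a, y)} ∅)).real (openConn a b) ≤
      (prodBernoulli (pinW w {s(a, y)} ∅)).real (openConn c b) := by
  set e : Sym2 (Fin n) := s(a, y) with he
  have hmeas : ∀ E : Set (BondConfig (Fin n)), MeasurableSet E := fun _ => MeasurableSet.of_discrete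
  have hoff := le_off_of_le w a c b {ω | e ∈ ω} (setOf_mem_pair_upClosure' a y hya) hle
  have hcyl : ({ω : BondConfig (Fin n) | e ∈ ω}ᶜ : Set (BondConfig (Fin n))) =
      localCylinder (↑({e} : Finset (Sym2 (Fin n))) : Set (Sym2 (Fin n))) ∅ := by
    ext ω
    simp only [Set.mem_compl_iff, Set.mem_setOf_eq, localCylinder, Finset.coe_singleton,
      Set.mem_singleton_iff, forall_eq, Set.mem_empty_iff_false, iff_false]
  have hpin : ∀ E : Set (BondConfig (Fin n)), (prodBernoulli w).real (E ∩ {ω : BondConfig (Fin n) | e ∈ ω}ᶜ) =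
      (prodBernoulli w).real (localCylinder (↑({e} : Finset (Sym2 (Fin n))) : Set (Sym2 (Fin n))) ∅) *
        (prodBernoulli (pinW w {e} ∅)).real E := by
    intro E
    rw [hcyl, prodBernoulli_real_inter_localCylinder w {e} ∅ (hmeas E), Finset.coe_singleton]
  have hc0 : 0 < (prodBernoulli w).real
      (localCylinder (↑({e} : Finset (Sym2 (Fin n))) : Set (Sym2 (Fin n))) ∅) := by
    rw [← hcyl, show ({ω : BondConfig (Fin n) | e ∈ ω}ᶜ : Set (BondConfig (Fin n))) = {ω | e ∉ ω} by
      ext ω; simp, prodBernoulli_real_setOf_notMem]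
    have : (w e : ℝ) < 1 := hw
    linarith
  rw [hpin, hpin] at hoff
  exact le_of_mul_le_mul_left hoff hc0

end

end Summit.CriticalPhenomena.PercolationContinuityZ3.Theorems
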